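import Summits.BirchSwinnertonDyer.BirchSwinnertonDyer.Theorems.EdixhovenFibreFiveSevenStarredOptimalManinUnitFiveSevenRecTowerAtCyclotomicOverCompletion
import Summits.BirchSwinnertonDyer.BirchSwinnertonDyer.Theorems.EdixhovenFibreFiveSevenStarredOptimalManinUnitFiveSevenRecTowerKData
import Summits.BirchSwinnertonDyer.BirchSwinnertonDyer.Theorems.KimAtThreeFineKatoKPortJunctionLog
import HarnessLib

/-!
# The two intrinsic REC stubs of skeleton v8 ⟸ KATO'S FORMULA OVER THE CELLS' FIELDS OF GOOD REDUCTION — the sockets of skeleton v9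
# (route `EdixhovenFibreFiveSeven`, crux K★ stmt-BirchSwinnertonDyer-22226, line `kato-lever`; seat `bsd-line-edix-p1` g30, LEAD)

HONEST FRAMING. TOOL theorems only (no definition, no named fact, no instance, no `sorry`; file-local instance keys on `ℚ_v` byte-identical to
`…RecTowerAtCyclotomicOverExt` l.85–89); nothing is closed; BSD / K★ / the REC stubs are NOT proved by this.

WHAT. ★★★ `recTowerSupersingularCells_of_localFormula` / ★★★ `recTowerOrdinaryCells_of_localFormula`: the statements of
`stub_recTowerSupersingularCells` / `stub_recTowerOrdinaryCells` of skeleton v8 (`Lines/kato_lever.lean`, VERBATIM conclusions) from ONE displayed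
hypothesis each — Kato's explicit reciprocity formula for the DIRECT representation `V_pW′|_{Γ_{K_{v′}}}` of the cell curve `W′/ℚ` ITSELF over the
completion `K_{v′}` of ANY number field `K` containing an `e`-th root `α` of `p` (`e` from the cell table: `(5; IV*) ↦ 3`, `(5; II*) ↦ 6`,
`(7; III*) ↦ 4`; `(5; III*) ↦ 4`, `(7; IV*) ↦ 3`, `(7; II*) ↦ 6`) at ANY place `v′ ∋ p`, with the packet keys, ANY compatible `ω′`, the Weil tower
of `W′`, and the Prop-1.2.3 binders of the direct representation HANDED OVER: `∀ d″ ∃ c′, ⟨[η″], P′⟩ = Tr_{K_{v′}/ℚ_p}(c′ · exp*_{d″}(η″) · log_{ω′} P′)`.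
NO cyclotomic level, NO tower, NO descent, NO Galois averaging, NO line-datum compatibility is left in the socket: all of it is
`…RecTowerAtCyclotomicOverCompletion.recTowerAt_cyclotomic_cells_of_formula_over_completion` (LEAD g30) fed with the K-DATA
`…RecTowerKData.exists_numberField_over_cyclotomic_pow_eq_prime` (`K = ℚ(ζ_m, p^{1/e})`, `w′ ∣ w`), the keys of `K_{w′}`, the compatible NORM valuation
(`compatible_normValuation_adicCompletion`, integrality `KPort.Kw.isIntegral_baseChange_of_isGloballyMinimal`) and de Rham ascent for the handed-over binders.
These two hypotheses are the sockets `stub_localFormulaSupersingularCells` / `stub_localFormulaOrdinaryCells` of skeleton v9; the supersingular one is the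
target of the (K₂)^ram road (`…TransportedReciprocityAllPoints` ∘ transport T5-E ∘ per-cell model data, cf. `…SupersingularCellsModels`).

* `compatible_normValuation_adicCompletion` — Mathlib's norm valuation of `K_v` (base `N(v)`) is compatible with the tree's valuative relation.
* ★★★ `recTowerSupersingularCells_of_localFormula`, ★★★ `recTowerOrdinaryCells_of_localFormula`.

References: [Kato1993LNM1553] Ch. II §1.2.4, Prop. 1.2.3, Ex. 1.3.5, Thm. 1.4.1 (3)–(4); [BrinonConrad2009] Prop. 6.3.8; [SilvermanAEC2009] VII.5.5,
Thm. IV.6.4; [SilvermanATAEC1994] IV Table 4.1; [SerreLocalFields1979] II §1.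
-/

set_option autoImplicit false
-- the Theorems namespace of a single-conjunct summit repeats the summit name by design (D-0017)
set_option linter.dupNamespace false

noncomputable section

open scoped Classical NNReal TensorProduct NumberField
open CategoryTheory Function Field ValuativeRel IsDedekindDomain NumberField
open Literature.NumberTheory.GaloisRepresentations
open Literature.NumberTheory.GaloisRepresentations.IsNonarchimedeanLocalField
open Literature.NumberTheory.GaloisRepresentations.PeriodRingData
open Literature.NumberTheory.PAdicHodge
open Literature.NumberTheory.EllipticCurves _root_.WeierstrassCurve
open Literature.NumberTheory.EllipticCurves.FormalGroupChart (padicLogPointFiniteExt)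
open Summit.BirchSwinnertonDyer.BirchSwinnertonDyer.Theorems.StarredOptimalManinUnitFiveSevenRecTowerAtCyclotomicOverExt
open Summit.BirchSwinnertonDyer.BirchSwinnertonDyer.Theorems.StarredOptimalManinUnitFiveSevenRecTowerAtCyclotomicOverCompletion
open Summit.BirchSwinnertonDyer.BirchSwinnertonDyer.Theorems.KimAtThreeDeepLowerExpStarOmega
open Summit.BirchSwinnertonDyer.BirchSwinnertonDyer.Theorems.KimAtThreeDeepLowerExpStarOmegaPlace
open Summit.BirchSwinnertonDyer.BirchSwinnertonDyer.Theorems.KimAtThreeDeepUpperTowerLattice (fact_natCast_mem_primesEquiv_symm)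
open Summit.BirchSwinnertonDyer.Rank1Residual.GaloisImage
open Rat.HeightOneSpectrum Literature.NumberTheory.DiophantineGeometry
open Summit.BirchSwinnertonDyer.Rank1Residual Summit.BirchSwinnertonDyer.Rank1Residual.Additive
  Literature.NumberTheory.EllipticCurves.Rank1Residual
open Literature.NumberTheory.AdelicBaseChange

namespace Summit.BirchSwinnertonDyer.BirchSwinnertonDyer.Theorems.StarredOptimalManinUnitFiveSevenRecTowerCellsOfLocalFormula

/-- **Mathlib's norm valuation `‖·‖₊` of the completion `K_v` of a number field (base `N(v)`, `instNormedFieldValuedAdicCompletion`) is compatible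
with the tree's valuative relation of `K_v`** (both are monotone images of `Valued.v`: `FinitePlace.norm_def`, `WithZeroMulInt.toNNReal_strictMono`).
[cite: SerreLocalFields1979, Ch. II §1] -/
theorem compatible_normValuation_adicCompletion {K : Type} [Field K] [NumberField K] (v : HeightOneSpectrum (𝓞 K)) :
    (NormedField.valuation : Valuation (v.adicCompletion K) ℝ≥0).Compatible := by
  refine ⟨fun x y => ?_⟩
  rw [(Valuation.Compatible.vle_iff_le (v := (Valued.v : Valuation (v.adicCompletion K) (WithZero (Multiplicative ℤ))))) x y,
    NormedField.valuation_apply, NormedField.valuation_apply, ← NNReal.coe_le_coe, coe_nnnorm, coe_nnnorm,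
    NumberField.FinitePlace.norm_def, NumberField.FinitePlace.norm_def, NNReal.coe_le_coe,
    (WithZeroMulInt.toNNReal_strictMono (NumberField.HeightOneSpectrum.one_lt_absNorm_nnreal v)).le_iff_le]

-- FILE-LOCAL instance keys, byte-identical to the accepted `…RecTowerAtCyclotomicOverExt.lean` l.85–89 (no library instance is
-- overridden outside this file): the `Fact (p ∈ v_p)` key and the local-field structures on `ℚ_v = Place.Completion (inr v_p)`.
attribute [local instance] fact_natCast_mem_primesEquiv_symm
attribute [local instance 100000] NumberField.Place.instAlgebraCompletion
attribute [local instance] valuativeRelPlace topologicalSpacePlace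
attribute [local instance] isNonarchimedeanLocalField_place charZero_place
attribute [local instance] padicAlgebraPlace fact_not_isUnit_place isAdicComplete_place

/-- ★★★ **`stub_recTowerSupersingularCells` ⟸ Kato's formula over the cells' fields of good reduction.** The VERBATIM statement of the
intrinsic supersingular REC stub of skeleton v8 (Kato's explicit reciprocity law at every globally minimal `W′` IN the cells `(5; IV*), (5; II*),
(7; III*)` and every cyclotomic tower `ℚ_v ⊆ ℚ(ζ_m)_w`, `p ∤ m`) from the socket `hloc`: the formula `⟨[η″], P′⟩ = Tr(c′·exp*_{d″}(η″)·log_{ω′} P′)`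
for the DIRECT representation of `W′` over `K_{v′}`, `K ∋ p^{1/e}` any number field, `v′ ∋ p` any place, `∀ d″ ∃ c′`.
[cite: Kato1993LNM1553, Ch. II §1.2.4, Prop. 1.2.3 and Thm. 1.4.1 (3)–(4)] [cite: BrinonConrad2009, Prop. 6.3.8] [cite: SilvermanATAEC1994, IV Table 4.1] -/
theorem recTowerSupersingularCells_of_localFormula (hloc :
    (∀ (W' : WeierstrassCurve ℚ) [W'.IsElliptic] [W'.IsGloballyMinimal] (p : ℕ) [Fact p.Prime], (p = 5 ∨ p = 7) → Addv W' p → Irr W' p →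
      (∀ (v : HeightOneSpectrum ℤ) (n : ℕ), natGenerator v = p → W'.kodairaSymbolAt v ≠ KodairaSymbol.Istar n) →
      4 < padicValInt p W'.minimalDiscriminantInt → ¬ (p = 5 ↔ padicValInt p W'.minimalDiscriminantInt = 9) →
      -- the field of good reduction: ANY number field `K` with an `e`-th root `α` of `p`, `e` from the cell table, at ANY place `v′ ∋ p`
      ∀ {K : Type} [Field K] [NumberField K] (α : K) (e : ℕ),
      (p = 5 ∧ padicValInt p W'.minimalDiscriminantInt = 8 ∧ e = 3 ∨ p = 5 ∧ padicValInt p W'.minimalDiscriminantInt = 10 ∧ e = 6 ∨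
        p = 7 ∧ padicValInt p W'.minimalDiscriminantInt = 9 ∧ e = 4) → α ^ e = (p : K) →
      ∀ (v' : HeightOneSpectrum (𝓞 K)) (hv' : ((p : ℕ) : 𝓞 K) ∈ v'.asIdeal)
      [CharZero (v'.adicCompletion K)] [Fact (¬ IsUnit ((p : ℕ) : integerC (v'.adicCompletion K)))]
      [IsAdicComplete (Ideal.span {((p : ℕ) : integerC (v'.adicCompletion K))}) (integerC (v'.adicCompletion K))]
      (hp' : valuation (v'.adicCompletion K) ((p : ℕ) : (v'.adicCompletion K)) < 1)
      (ω' : Valuation (v'.adicCompletion K) ℝ≥0) [ω'.Compatible] [(W'.baseChange (v'.adicCompletion K)).IsIntegral ω'.integer],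
      letI := LocalField.adicCompletionPadicAlgebra v' p hv'
      -- the Weil tower of `W′` over `ℚ`
      ∀ (e : (k : ℕ) → geomTorsion W' ((p ^ k : ℕ) : ℤ) → geomTorsion W' ((p ^ k : ℕ) : ℤ) → AlgebraicClosure ℚ) (hμ : ∀ k S T, e k S T ^ (p ^ k) = 1)
      (hadd₁ : ∀ k S₁ S₂ T, e k (S₁ + S₂) T = e k S₁ T * e k S₂ T) (hadd₂ : ∀ k S T₁ T₂, e k S (T₁ + T₂) = e k S T₁ * e k S T₂)
      (hgal : ∀ k (σ : absoluteGaloisGroup ℚ) (S T : geomTorsion W' ((p ^ k : ℕ) : ℤ)), σ • e k S T = e k (σ • S) (σ • T))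
      (_hnondeg : ∀ k (T : geomTorsion W' ((p ^ k : ℕ) : ℤ)), (∀ S, e k S T = 1) → T = 0) (hcompat : ∀ k (S T : geomTorsion W' ((p ^ (k + 1) : ℕ) : ℤ)),
      e k (torsionMulHom W' (p ^ (k + 1)) (p ^ k) p (pow_succ p k).symm S) (torsionMulHom W' (p ^ (k + 1)) (p ^ k) p (pow_succ p k).symm T) = e (k + 1) S T ^ p),
      -- the Prop-1.2.3 binders of the DIRECT representation over `K_{v′}` (handed over: de Rham ascent)
      (bdRPeriodRingData (F := (v'.adicCompletion K)) (p := p) hp').CupLogInjective (logCyclotomic p) (restrictedRationalTateRep W' (v'.adicCompletion K) p) →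
      (∀ z : contOneCocycles (restrictedRationalTateRep W' (v'.adicCompletion K) p).toTopRep,
        (bdRPeriodRingData (F := (v'.adicCompletion K)) (p := p) hp').HasDualExp (logCyclotomic p) (restrictedRationalTateRep W' (v'.adicCompletion K) p) fun σ => z.1 σ) →
      -- KATO'S FORMULA over `K_{v′}`: for every line datum SOME constant
      ∀ d'' : (bdRPeriodRingData (F := (v'.adicCompletion K)) (p := p) hp').FilZeroLine (restrictedRationalTateRep W' (v'.adicCompletion K) p), ∃ c' : (v'.adicCompletion K),
      ∀ (η'' : contOneCocycles (restrictedTateRep W' (v'.adicCompletion K) p).toTopRep) (P' : (W'.baseChange (v'.adicCompletion K)).toAffine.Point),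
      ((tatePairingPoint W' (v'.adicCompletion K) p e hμ hadd₁ hadd₂ hgal hcompat (oneCocycleClass _ η'') P' : ℤ_[p]) : ℚ_[p]) =
        Algebra.trace ℚ_[p] (v'.adicCompletion K) (c' * expStarCoord W' hp' d'' η'' * padicLogPointFiniteExt ω' (W'.baseChange (v'.adicCompletion K)) p P'))) :
    ∀ (W' : WeierstrassCurve ℚ) [W'.IsElliptic] [W'.IsGloballyMinimal] (p : ℕ) [hp : Fact p.Prime], (p = 5 ∨ p = 7) → Addv W' p → Irr W' p →
      (∀ (v : HeightOneSpectrum ℤ) (n : ℕ), natGenerator v = p → W'.kodairaSymbolAt v ≠ KodairaSymbol.Istar n) →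
      4 < padicValInt p W'.minimalDiscriminantInt → ¬ (p = 5 ↔ padicValInt p W'.minimalDiscriminantInt = 9) → ∀ (m : ℕ) [NeZero m], ¬ p ∣ m →
      ∀ (w : ((primesEquiv (R := 𝓞 ℚ)).symm ⟨p, hp.out⟩).Extension (𝓞 (CyclotomicField m ℚ))) (hw : ((p : ℕ) : 𝓞 (CyclotomicField m ℚ)) ∈ w.1.asIdeal)
      [CharZero (w.1.adicCompletion (CyclotomicField m ℚ))] [Fact (¬ IsUnit ((p : ℕ) : integerC (w.1.adicCompletion (CyclotomicField m ℚ))))]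
      [IsAdicComplete (Ideal.span {((p : ℕ) : integerC (w.1.adicCompletion (CyclotomicField m ℚ)))}) (integerC (w.1.adicCompletion (CyclotomicField m ℚ)))]
      (hL : valuation (w.1.adicCompletion (CyclotomicField m ℚ)) ((p : ℕ) : (w.1.adicCompletion (CyclotomicField m ℚ))) < 1), letI := LocalField.adicCompletionPadicAlgebra w.1 p hw
      letI : Algebra (Place.Completion (K := ℚ) (Sum.inr ((primesEquiv (R := 𝓞 ℚ)).symm ⟨p, hp.out⟩))) (w.1.adicCompletion (CyclotomicField m ℚ)) :=
      inferInstanceAs (Algebra (((primesEquiv (R := 𝓞 ℚ)).symm ⟨p, hp.out⟩).adicCompletion ℚ) (w.1.adicCompletion (CyclotomicField m ℚ)))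
      ∀ (wv : Valuation (Place.Completion (Sum.inr ((primesEquiv (R := 𝓞 ℚ)).symm ⟨p, hp.out⟩) : Place ℚ)) ℝ≥0) [wv.Compatible]
      [(W'.baseChange (Place.Completion (Sum.inr ((primesEquiv (R := 𝓞 ℚ)).symm ⟨p, hp.out⟩) : Place ℚ))).IsIntegral wv.integer]
      (ν : Valuation (w.1.adicCompletion (CyclotomicField m ℚ)) ℝ≥0) [ν.Compatible] [(W'.baseChange (w.1.adicCompletion (CyclotomicField m ℚ))).IsIntegral ν.integer]
      (e : (k : ℕ) → geomTorsion W' ((p ^ k : ℕ) : ℤ) → geomTorsion W' ((p ^ k : ℕ) : ℤ) → AlgebraicClosure ℚ) (hμ : ∀ k S T, e k S T ^ (p ^ k) = 1)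
      (hadd₁ : ∀ k S₁ S₂ T, e k (S₁ + S₂) T = e k S₁ T * e k S₂ T) (hadd₂ : ∀ k S T₁ T₂, e k S (T₁ + T₂) = e k S T₁ * e k S T₂)
      (hgal : ∀ k (σ : absoluteGaloisGroup ℚ) (S T : geomTorsion W' ((p ^ k : ℕ) : ℤ)), σ • e k S T = e k (σ • S) (σ • T))
      (_hnondeg : ∀ k (T : geomTorsion W' ((p ^ k : ℕ) : ℤ)), (∀ S, e k S T = 1) → T = 0) (hcompat : ∀ k (S T : geomTorsion W' ((p ^ (k + 1) : ℕ) : ℤ)),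
      e k (torsionMulHom W' (p ^ (k + 1)) (p ^ k) p (pow_succ p k).symm S) (torsionMulHom W' (p ^ (k + 1)) (p ^ k) p (pow_succ p k).symm T) = e (k + 1) S T ^ p)
      (d₀ : LocalNeronLineAt W' p ((primesEquiv (R := 𝓞 ℚ)).symm ⟨p, hp.out⟩)) (d : LocalNeronLine W' hL ((galRestrictPlace ((primesEquiv (R := 𝓞 ℚ)).symm ⟨p, hp.out⟩)).comp
      (absGaloisRestrict (Place.Completion (Sum.inr ((primesEquiv (R := 𝓞 ℚ)).symm ⟨p, hp.out⟩) : Place ℚ)) (w.1.adicCompletion (CyclotomicField m ℚ))))),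
      (bdRPeriodRingData (valuation_place_lt_one p ((primesEquiv (R := 𝓞 ℚ)).symm ⟨p, hp.out⟩))).CupLogInjective (logCyclotomic p)
      (localRationalTateRep W' p (galRestrictPlace ((primesEquiv (R := 𝓞 ℚ)).symm ⟨p, hp.out⟩))) →
      (∀ z : contOneCocycles (localRationalTateRep W' p (galRestrictPlace ((primesEquiv (R := 𝓞 ℚ)).symm ⟨p, hp.out⟩))).toTopRep,
      (bdRPeriodRingData (valuation_place_lt_one p ((primesEquiv (R := 𝓞 ℚ)).symm ⟨p, hp.out⟩))).HasDualExp (logCyclotomic p)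
      (localRationalTateRep W' p (galRestrictPlace ((primesEquiv (R := 𝓞 ℚ)).symm ⟨p, hp.out⟩))) fun σ => z.1 σ) →
      (bdRPeriodRingData (F := (w.1.adicCompletion (CyclotomicField m ℚ))) (p := p) hL).CupLogInjective (logCyclotomic p) (localRationalTateRep W' p
      ((galRestrictPlace ((primesEquiv (R := 𝓞 ℚ)).symm ⟨p, hp.out⟩)).comp (absGaloisRestrict (Place.Completion (Sum.inr ((primesEquiv (R := 𝓞 ℚ)).symm ⟨p, hp.out⟩) : Place ℚ)) (w.1.adicCompletion (CyclotomicField m ℚ))))) →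
      (∀ z : contOneCocycles (localRationalTateRep W' p
      ((galRestrictPlace ((primesEquiv (R := 𝓞 ℚ)).symm ⟨p, hp.out⟩)).comp (absGaloisRestrict (Place.Completion (Sum.inr ((primesEquiv (R := 𝓞 ℚ)).symm ⟨p, hp.out⟩) : Place ℚ)) (w.1.adicCompletion (CyclotomicField m ℚ))))).toTopRep,
      (bdRPeriodRingData (F := (w.1.adicCompletion (CyclotomicField m ℚ))) (p := p) hL).HasDualExp (logCyclotomic p) (localRationalTateRep W' p
      ((galRestrictPlace ((primesEquiv (R := 𝓞 ℚ)).symm ⟨p, hp.out⟩)).comp (absGaloisRestrict (Place.Completion (Sum.inr ((primesEquiv (R := 𝓞 ℚ)).symm ⟨p, hp.out⟩) : Place ℚ)) (w.1.adicCompletion (CyclotomicField m ℚ)))))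
      fun σ => z.1 σ) → (∀ (η₀ : contOneCocycles (restrictedTateRep W' (Place.Completion (Sum.inr ((primesEquiv (R := 𝓞 ℚ)).symm ⟨p, hp.out⟩) : Place ℚ)) p).toTopRep)
      (ηT : contOneCocycles ((restrictedTateRep W' (Place.Completion (Sum.inr ((primesEquiv (R := 𝓞 ℚ)).symm ⟨p, hp.out⟩) : Place ℚ)) p).restrict
      (absGaloisRestrict (Place.Completion (Sum.inr ((primesEquiv (R := 𝓞 ℚ)).symm ⟨p, hp.out⟩) : Place ℚ)) (w.1.adicCompletion (CyclotomicField m ℚ)))).toTopRep),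
      (∀ σ, ηT.1 σ = η₀.1 (absGaloisRestrict (Place.Completion (Sum.inr ((primesEquiv (R := 𝓞 ℚ)).symm ⟨p, hp.out⟩) : Place ℚ)) (w.1.adicCompletion (CyclotomicField m ℚ)) σ)) →
      expStarCoordTower W' (F₀ := (Place.Completion (Sum.inr ((primesEquiv (R := 𝓞 ℚ)).symm ⟨p, hp.out⟩) : Place ℚ))) hL d ηT =
      algebraMap (Place.Completion (Sum.inr ((primesEquiv (R := 𝓞 ℚ)).symm ⟨p, hp.out⟩) : Place ℚ)) (w.1.adicCompletion (CyclotomicField m ℚ))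
      (expStarCoord W' (valuation_place_lt_one p ((primesEquiv (R := 𝓞 ℚ)).symm ⟨p, hp.out⟩)) d₀ η₀)) →
      ∃ c : (Place.Completion (Sum.inr ((primesEquiv (R := 𝓞 ℚ)).symm ⟨p, hp.out⟩) : Place ℚ)), c ≠ 0 ∧
      (∀ (η₀ : contOneCocycles (restrictedTateRep W' (Place.Completion (Sum.inr ((primesEquiv (R := 𝓞 ℚ)).symm ⟨p, hp.out⟩) : Place ℚ)) p).toTopRep)
      (P : (W'.baseChange (Place.Completion (Sum.inr ((primesEquiv (R := 𝓞 ℚ)).symm ⟨p, hp.out⟩) : Place ℚ))).toAffine.Point),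
      ((tatePairingPoint W' (Place.Completion (Sum.inr ((primesEquiv (R := 𝓞 ℚ)).symm ⟨p, hp.out⟩) : Place ℚ)) p e hμ hadd₁ hadd₂ hgal hcompat (oneCocycleClass _ η₀) P : ℤ_[p]) : ℚ_[p]) =
      Algebra.trace ℚ_[p] (Place.Completion (Sum.inr ((primesEquiv (R := 𝓞 ℚ)).symm ⟨p, hp.out⟩) : Place ℚ))
      (c * expStarCoord W' (valuation_place_lt_one p ((primesEquiv (R := 𝓞 ℚ)).symm ⟨p, hp.out⟩)) d₀ η₀ *
      padicLogPointFiniteExt wv (W'.baseChange (Place.Completion (Sum.inr ((primesEquiv (R := 𝓞 ℚ)).symm ⟨p, hp.out⟩) : Place ℚ))) p P)) ∧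
      (∀ (ηT : contOneCocycles ((restrictedTateRep W' (Place.Completion (Sum.inr ((primesEquiv (R := 𝓞 ℚ)).symm ⟨p, hp.out⟩) : Place ℚ)) p).restrict
      (absGaloisRestrict (Place.Completion (Sum.inr ((primesEquiv (R := 𝓞 ℚ)).symm ⟨p, hp.out⟩) : Place ℚ)) (w.1.adicCompletion (CyclotomicField m ℚ)))).toTopRep)
      (P : (W'.baseChange (w.1.adicCompletion (CyclotomicField m ℚ))).toAffine.Point),
      ((tatePairingPointTower W' (Place.Completion (Sum.inr ((primesEquiv (R := 𝓞 ℚ)).symm ⟨p, hp.out⟩) : Place ℚ)) e hμ hadd₁ hadd₂ hgal hcompat (oneCocycleClass _ ηT) P : ℤ_[p]) : ℚ_[p]) =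
      Algebra.trace ℚ_[p] (w.1.adicCompletion (CyclotomicField m ℚ))
      (algebraMap (Place.Completion (Sum.inr ((primesEquiv (R := 𝓞 ℚ)).symm ⟨p, hp.out⟩) : Place ℚ)) (w.1.adicCompletion (CyclotomicField m ℚ)) c * expStarCoordTower W' (F₀ := (Place.Completion (Sum.inr ((primesEquiv (R := 𝓞 ℚ)).symm ⟨p, hp.out⟩) : Place ℚ))) hL d ηT *
      padicLogPointFiniteExt ν (W'.baseChange (w.1.adicCompletion (CyclotomicField m ℚ))) p P)) := by
  intro W' _ _ p hp hp57 hadd hirr hIstar h4 hsel m _ hm w hw _ _ _ hL wv _ _ ν _ _ e hμ hadd₁ hadd₂ hgal hnondeg hcompat d₀ d hcli₀ hde₀ hcli hde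
    hcomp
  have hp5 : 5 ≤ p := by rcases hp57 with rfl | rfl <;> norm_num
  have hgen : natGenerator (placeOf p) = p := congrArg Subtype.val ((primesEquiv (R := ℤ)).apply_symm_apply ⟨p, hp.out⟩)
  obtain ⟨-, hvΔ⟩ := padicValRat_j_nonneg_and_mem_of_starred W' p hp5 hadd (fun n => hIstar (placeOf p) n hgen) h4
  -- the cell's ramification index `e` (Tate's table: ord_p Δ_min ∈ {8, 9, 10}; the selector excludes `(5; III*)` / forces `(7; III*)`)
  obtain ⟨e', he', htab⟩ : ∃ e' : ℕ, 0 < e' ∧ (p = 5 ∧ padicValInt p W'.minimalDiscriminantInt = 8 ∧ e' = 3 ∨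
      p = 5 ∧ padicValInt p W'.minimalDiscriminantInt = 10 ∧ e' = 6 ∨ p = 7 ∧ padicValInt p W'.minimalDiscriminantInt = 9 ∧ e' = 4) := by
    rcases hp57 with rfl | rfl
    · rcases hvΔ with h8 | h9 | h10
      · exact ⟨3, by norm_num, Or.inl ⟨rfl, h8, rfl⟩⟩
      · exact absurd ⟨fun _ => h9, fun _ => rfl⟩ hsel
      · exact ⟨6, by norm_num, Or.inr (Or.inl ⟨rfl, h10, rfl⟩)⟩
    · have h9 : padicValInt 7 W'.minimalDiscriminantInt = 9 := by
        by_contra h; exact hsel ⟨fun h7 => by norm_num at h7, fun h9 => absurd h9 h⟩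
      exact ⟨4, by norm_num, Or.inr (Or.inr ⟨rfl, h9, rfl⟩)⟩
  -- K-DATA: `K = ℚ(ζ_m, p^{1/e})`, a place `w′ ∣ w`, the packet keys of `K_{w′}`, the compatible norm valuation
  obtain ⟨K, _, _, _, _, α, hα, hpl⟩ := StarredOptimalManinUnitFiveSevenRecTowerKData.exists_numberField_over_cyclotomic_pow_eq_prime m he' p
  obtain ⟨w', hw'⟩ := hpl w.1 hw
  haveI : CharZero (w'.1.adicCompletion K) := LocalField.charZero_adicCompletion w'.1
  have hp' : valuation (w'.1.adicCompletion K) ((p : ℕ) : w'.1.adicCompletion K) < 1 := LocalField.valuation_adicCompletion_natCast_lt_one w'.1 p hw'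
  haveI : Fact (¬ IsUnit ((p : ℕ) : integerC (w'.1.adicCompletion K))) := ⟨not_isUnit_natCast_integerC hp'⟩
  haveI : IsAdicComplete (Ideal.span {((p : ℕ) : integerC (w'.1.adicCompletion K))}) (integerC (w'.1.adicCompletion K)) :=
    isAdicComplete_integerC_natCast hp'
  haveI := compatible_normValuation_adicCompletion (K := K) w'.1
  haveI : (W'.baseChange (w'.1.adicCompletion K)).IsIntegral (NormedField.valuation : Valuation (w'.1.adicCompletion K) ℝ≥0).integer :=
    KPort.Kw.isIntegral_baseChange_of_isGloballyMinimal _ W'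
  letI := LocalField.adicCompletionPadicAlgebra w.1 p hw
  letI : Algebra (Place.Completion (K := ℚ) (Sum.inr ((primesEquiv (R := 𝓞 ℚ)).symm ⟨p, hp.out⟩))) (w.1.adicCompletion (CyclotomicField m ℚ)) :=
    inferInstanceAs (Algebra (((primesEquiv (R := 𝓞 ℚ)).symm ⟨p, hp.out⟩).adicCompletion ℚ) (w.1.adicCompletion (CyclotomicField m ℚ)))
  letI := LocalField.adicCompletionPadicAlgebra w'.1 p hw'
  -- the Prop-1.2.3 binders of the direct representation over `K_{w′}`: de Rham ascent `ℚ_v → L_w → K_{w′}` + Kato II Prop. 1.2.3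
  have hcont : Continuous (algebraMap (Place.Completion (Sum.inr ((primesEquiv (R := 𝓞 ℚ)).symm ⟨p, hp.out⟩) : Place ℚ)) (w.1.adicCompletion (CyclotomicField m ℚ))) := w.adicCompletionSemialgHom_continuous ℚ (CyclotomicField m ℚ)
  haveI : Module.Finite ℚ_[p] (W'.rationalTateModule p) := module_finite_rationalTateModule_holds W' p
  have hDRK : GaloisRep.IsDeRham (bdRPeriodRingData (F := w'.1.adicCompletion K) (p := p) hp')
      (restrictedRationalTateRep W' (w'.1.adicCompletion K) p) :=
    isDeRham_restrictedRationalTateRep_of_tower W' (w'.adicCompletionSemialgHom_continuous (CyclotomicField m ℚ) K) hL hp'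
      (isDeRham_restrictedRationalTateRep_of_tower W' hcont (valuation_place_lt_one p ((primesEquiv (R := 𝓞 ℚ)).symm ⟨p, hp.out⟩)) hL
        (isDeRham_place_of_starredCell W' p hp57 hadd hirr hIstar h4))
  obtain ⟨hinjK, hdeK⟩ := cupLogInjective_and_hasDualExp_of_isDeRham_holds hp' (restrictedRationalTateRep W' (w'.1.adicCompletion K) p) hDRK
  exact recTowerAt_cyclotomic_cells_of_formula_over_completion W' p hp57 hadd hirr hIstar h4 m w hw hL wv ν w' hw' hp'
    (NormedField.valuation : Valuation (w'.1.adicCompletion K) ℝ≥0) e hμ hadd₁ hadd₂ hgal hcompat hnondeg hcli hde d₀ d hcomp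
    (hloc W' p hp57 hadd hirr hIstar h4 hsel α e' htab hα w'.1 hw' hp' NormedField.valuation e hμ hadd₁ hadd₂ hgal hnondeg hcompat hinjK hdeK)

/-- ★★★ **`stub_recTowerOrdinaryCells` ⟸ Kato's formula over the cells' fields of good reduction** (the (G)-ORDINARY cells `(5; III*), (7; IV*),
(7; II*)`; same shape, cell table `4, 3, 6`). The ordinary road itself (two-component period frame, memo §6bis) is NOT supplied here.
[cite: Kato1993LNM1553, Ch. II §1.2.4, Prop. 1.2.3 and Thm. 1.4.1 (3)–(4)] [cite: BrinonConrad2009, Prop. 6.3.8] [cite: SilvermanATAEC1994, IV Table 4.1] -/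
theorem recTowerOrdinaryCells_of_localFormula (hloc :
    (∀ (W' : WeierstrassCurve ℚ) [W'.IsElliptic] [W'.IsGloballyMinimal] (p : ℕ) [Fact p.Prime], (p = 5 ∨ p = 7) → Addv W' p → Irr W' p →
      (∀ (v : HeightOneSpectrum ℤ) (n : ℕ), natGenerator v = p → W'.kodairaSymbolAt v ≠ KodairaSymbol.Istar n) →
      4 < padicValInt p W'.minimalDiscriminantInt → (p = 5 ↔ padicValInt p W'.minimalDiscriminantInt = 9) →
      -- the field of good reduction: ANY number field `K` with an `e`-th root `α` of `p`, `e` from the cell table, at ANY place `v′ ∋ p`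
      ∀ {K : Type} [Field K] [NumberField K] (α : K) (e : ℕ),
      (p = 5 ∧ padicValInt p W'.minimalDiscriminantInt = 9 ∧ e = 4 ∨ p = 7 ∧ padicValInt p W'.minimalDiscriminantInt = 8 ∧ e = 3 ∨
        p = 7 ∧ padicValInt p W'.minimalDiscriminantInt = 10 ∧ e = 6) → α ^ e = (p : K) →
      ∀ (v' : HeightOneSpectrum (𝓞 K)) (hv' : ((p : ℕ) : 𝓞 K) ∈ v'.asIdeal)
      [CharZero (v'.adicCompletion K)] [Fact (¬ IsUnit ((p : ℕ) : integerC (v'.adicCompletion K)))]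
      [IsAdicComplete (Ideal.span {((p : ℕ) : integerC (v'.adicCompletion K))}) (integerC (v'.adicCompletion K))]
      (hp' : valuation (v'.adicCompletion K) ((p : ℕ) : (v'.adicCompletion K)) < 1)
      (ω' : Valuation (v'.adicCompletion K) ℝ≥0) [ω'.Compatible] [(W'.baseChange (v'.adicCompletion K)).IsIntegral ω'.integer],
      letI := LocalField.adicCompletionPadicAlgebra v' p hv'
      -- the Weil tower of `W′` over `ℚ`
      ∀ (e : (k : ℕ) → geomTorsion W' ((p ^ k : ℕ) : ℤ) → geomTorsion W' ((p ^ k : ℕ) : ℤ) → AlgebraicClosure ℚ) (hμ : ∀ k S T, e k S T ^ (p ^ k) = 1)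
      (hadd₁ : ∀ k S₁ S₂ T, e k (S₁ + S₂) T = e k S₁ T * e k S₂ T) (hadd₂ : ∀ k S T₁ T₂, e k S (T₁ + T₂) = e k S T₁ * e k S T₂)
      (hgal : ∀ k (σ : absoluteGaloisGroup ℚ) (S T : geomTorsion W' ((p ^ k : ℕ) : ℤ)), σ • e k S T = e k (σ • S) (σ • T))
      (_hnondeg : ∀ k (T : geomTorsion W' ((p ^ k : ℕ) : ℤ)), (∀ S, e k S T = 1) → T = 0) (hcompat : ∀ k (S T : geomTorsion W' ((p ^ (k + 1) : ℕ) : ℤ)),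
      e k (torsionMulHom W' (p ^ (k + 1)) (p ^ k) p (pow_succ p k).symm S) (torsionMulHom W' (p ^ (k + 1)) (p ^ k) p (pow_succ p k).symm T) = e (k + 1) S T ^ p),
      -- the Prop-1.2.3 binders of the DIRECT representation over `K_{v′}` (handed over: de Rham ascent)
      (bdRPeriodRingData (F := (v'.adicCompletion K)) (p := p) hp').CupLogInjective (logCyclotomic p) (restrictedRationalTateRep W' (v'.adicCompletion K) p) →
      (∀ z : contOneCocycles (restrictedRationalTateRep W' (v'.adicCompletion K) p).toTopRep,
        (bdRPeriodRingData (F := (v'.adicCompletion K)) (p := p) hp').HasDualExp (logCyclotomic p) (restrictedRationalTateRep W' (v'.adicCompletion K) p) fun σ => z.1 σ) →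
      -- KATO'S FORMULA over `K_{v′}`: for every line datum SOME constant
      ∀ d'' : (bdRPeriodRingData (F := (v'.adicCompletion K)) (p := p) hp').FilZeroLine (restrictedRationalTateRep W' (v'.adicCompletion K) p), ∃ c' : (v'.adicCompletion K),
      ∀ (η'' : contOneCocycles (restrictedTateRep W' (v'.adicCompletion K) p).toTopRep) (P' : (W'.baseChange (v'.adicCompletion K)).toAffine.Point),
      ((tatePairingPoint W' (v'.adicCompletion K) p e hμ hadd₁ hadd₂ hgal hcompat (oneCocycleClass _ η'') P' : ℤ_[p]) : ℚ_[p]) =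
        Algebra.trace ℚ_[p] (v'.adicCompletion K) (c' * expStarCoord W' hp' d'' η'' * padicLogPointFiniteExt ω' (W'.baseChange (v'.adicCompletion K)) p P'))) :
    ∀ (W' : WeierstrassCurve ℚ) [W'.IsElliptic] [W'.IsGloballyMinimal] (p : ℕ) [hp : Fact p.Prime], (p = 5 ∨ p = 7) → Addv W' p → Irr W' p →
      (∀ (v : HeightOneSpectrum ℤ) (n : ℕ), natGenerator v = p → W'.kodairaSymbolAt v ≠ KodairaSymbol.Istar n) →
      4 < padicValInt p W'.minimalDiscriminantInt → (p = 5 ↔ padicValInt p W'.minimalDiscriminantInt = 9) → ∀ (m : ℕ) [NeZero m], ¬ p ∣ m →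
      ∀ (w : ((primesEquiv (R := 𝓞 ℚ)).symm ⟨p, hp.out⟩).Extension (𝓞 (CyclotomicField m ℚ))) (hw : ((p : ℕ) : 𝓞 (CyclotomicField m ℚ)) ∈ w.1.asIdeal)
      [CharZero (w.1.adicCompletion (CyclotomicField m ℚ))] [Fact (¬ IsUnit ((p : ℕ) : integerC (w.1.adicCompletion (CyclotomicField m ℚ))))]
      [IsAdicComplete (Ideal.span {((p : ℕ) : integerC (w.1.adicCompletion (CyclotomicField m ℚ)))}) (integerC (w.1.adicCompletion (CyclotomicField m ℚ)))]
      (hL : valuation (w.1.adicCompletion (CyclotomicField m ℚ)) ((p : ℕ) : (w.1.adicCompletion (CyclotomicField m ℚ))) < 1), letI := LocalField.adicCompletionPadicAlgebra w.1 p hw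
      letI : Algebra (Place.Completion (K := ℚ) (Sum.inr ((primesEquiv (R := 𝓞 ℚ)).symm ⟨p, hp.out⟩))) (w.1.adicCompletion (CyclotomicField m ℚ)) :=
      inferInstanceAs (Algebra (((primesEquiv (R := 𝓞 ℚ)).symm ⟨p, hp.out⟩).adicCompletion ℚ) (w.1.adicCompletion (CyclotomicField m ℚ)))
      ∀ (wv : Valuation (Place.Completion (Sum.inr ((primesEquiv (R := 𝓞 ℚ)).symm ⟨p, hp.out⟩) : Place ℚ)) ℝ≥0) [wv.Compatible]
      [(W'.baseChange (Place.Completion (Sum.inr ((primesEquiv (R := 𝓞 ℚ)).symm ⟨p, hp.out⟩) : Place ℚ))).IsIntegral wv.integer]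
      (ν : Valuation (w.1.adicCompletion (CyclotomicField m ℚ)) ℝ≥0) [ν.Compatible] [(W'.baseChange (w.1.adicCompletion (CyclotomicField m ℚ))).IsIntegral ν.integer]
      (e : (k : ℕ) → geomTorsion W' ((p ^ k : ℕ) : ℤ) → geomTorsion W' ((p ^ k : ℕ) : ℤ) → AlgebraicClosure ℚ) (hμ : ∀ k S T, e k S T ^ (p ^ k) = 1)
      (hadd₁ : ∀ k S₁ S₂ T, e k (S₁ + S₂) T = e k S₁ T * e k S₂ T) (hadd₂ : ∀ k S T₁ T₂, e k S (T₁ + T₂) = e k S T₁ * e k S T₂)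
      (hgal : ∀ k (σ : absoluteGaloisGroup ℚ) (S T : geomTorsion W' ((p ^ k : ℕ) : ℤ)), σ • e k S T = e k (σ • S) (σ • T))
      (_hnondeg : ∀ k (T : geomTorsion W' ((p ^ k : ℕ) : ℤ)), (∀ S, e k S T = 1) → T = 0) (hcompat : ∀ k (S T : geomTorsion W' ((p ^ (k + 1) : ℕ) : ℤ)),
      e k (torsionMulHom W' (p ^ (k + 1)) (p ^ k) p (pow_succ p k).symm S) (torsionMulHom W' (p ^ (k + 1)) (p ^ k) p (pow_succ p k).symm T) = e (k + 1) S T ^ p)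
      (d₀ : LocalNeronLineAt W' p ((primesEquiv (R := 𝓞 ℚ)).symm ⟨p, hp.out⟩)) (d : LocalNeronLine W' hL ((galRestrictPlace ((primesEquiv (R := 𝓞 ℚ)).symm ⟨p, hp.out⟩)).comp
      (absGaloisRestrict (Place.Completion (Sum.inr ((primesEquiv (R := 𝓞 ℚ)).symm ⟨p, hp.out⟩) : Place ℚ)) (w.1.adicCompletion (CyclotomicField m ℚ))))),
      (bdRPeriodRingData (valuation_place_lt_one p ((primesEquiv (R := 𝓞 ℚ)).symm ⟨p, hp.out⟩))).CupLogInjective (logCyclotomic p)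
      (localRationalTateRep W' p (galRestrictPlace ((primesEquiv (R := 𝓞 ℚ)).symm ⟨p, hp.out⟩))) →
      (∀ z : contOneCocycles (localRationalTateRep W' p (galRestrictPlace ((primesEquiv (R := 𝓞 ℚ)).symm ⟨p, hp.out⟩))).toTopRep,
      (bdRPeriodRingData (valuation_place_lt_one p ((primesEquiv (R := 𝓞 ℚ)).symm ⟨p, hp.out⟩))).HasDualExp (logCyclotomic p)
      (localRationalTateRep W' p (galRestrictPlace ((primesEquiv (R := 𝓞 ℚ)).symm ⟨p, hp.out⟩))) fun σ => z.1 σ) →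
      (bdRPeriodRingData (F := (w.1.adicCompletion (CyclotomicField m ℚ))) (p := p) hL).CupLogInjective (logCyclotomic p) (localRationalTateRep W' p
      ((galRestrictPlace ((primesEquiv (R := 𝓞 ℚ)).symm ⟨p, hp.out⟩)).comp (absGaloisRestrict (Place.Completion (Sum.inr ((primesEquiv (R := 𝓞 ℚ)).symm ⟨p, hp.out⟩) : Place ℚ)) (w.1.adicCompletion (CyclotomicField m ℚ))))) →
      (∀ z : contOneCocycles (localRationalTateRep W' p
      ((galRestrictPlace ((primesEquiv (R := 𝓞 ℚ)).symm ⟨p, hp.out⟩)).comp (absGaloisRestrict (Place.Completion (Sum.inr ((primesEquiv (R := 𝓞 ℚ)).symm ⟨p, hp.out⟩) : Place ℚ)) (w.1.adicCompletion (CyclotomicField m ℚ))))).toTopRep,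
      (bdRPeriodRingData (F := (w.1.adicCompletion (CyclotomicField m ℚ))) (p := p) hL).HasDualExp (logCyclotomic p) (localRationalTateRep W' p
      ((galRestrictPlace ((primesEquiv (R := 𝓞 ℚ)).symm ⟨p, hp.out⟩)).comp (absGaloisRestrict (Place.Completion (Sum.inr ((primesEquiv (R := 𝓞 ℚ)).symm ⟨p, hp.out⟩) : Place ℚ)) (w.1.adicCompletion (CyclotomicField m ℚ)))))
      fun σ => z.1 σ) → (∀ (η₀ : contOneCocycles (restrictedTateRep W' (Place.Completion (Sum.inr ((primesEquiv (R := 𝓞 ℚ)).symm ⟨p, hp.out⟩) : Place ℚ)) p).toTopRep)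
      (ηT : contOneCocycles ((restrictedTateRep W' (Place.Completion (Sum.inr ((primesEquiv (R := 𝓞 ℚ)).symm ⟨p, hp.out⟩) : Place ℚ)) p).restrict
      (absGaloisRestrict (Place.Completion (Sum.inr ((primesEquiv (R := 𝓞 ℚ)).symm ⟨p, hp.out⟩) : Place ℚ)) (w.1.adicCompletion (CyclotomicField m ℚ)))).toTopRep),
      (∀ σ, ηT.1 σ = η₀.1 (absGaloisRestrict (Place.Completion (Sum.inr ((primesEquiv (R := 𝓞 ℚ)).symm ⟨p, hp.out⟩) : Place ℚ)) (w.1.adicCompletion (CyclotomicField m ℚ)) σ)) →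
      expStarCoordTower W' (F₀ := (Place.Completion (Sum.inr ((primesEquiv (R := 𝓞 ℚ)).symm ⟨p, hp.out⟩) : Place ℚ))) hL d ηT =
      algebraMap (Place.Completion (Sum.inr ((primesEquiv (R := 𝓞 ℚ)).symm ⟨p, hp.out⟩) : Place ℚ)) (w.1.adicCompletion (CyclotomicField m ℚ))
      (expStarCoord W' (valuation_place_lt_one p ((primesEquiv (R := 𝓞 ℚ)).symm ⟨p, hp.out⟩)) d₀ η₀)) →
      ∃ c : (Place.Completion (Sum.inr ((primesEquiv (R := 𝓞 ℚ)).symm ⟨p, hp.out⟩) : Place ℚ)), c ≠ 0 ∧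
      (∀ (η₀ : contOneCocycles (restrictedTateRep W' (Place.Completion (Sum.inr ((primesEquiv (R := 𝓞 ℚ)).symm ⟨p, hp.out⟩) : Place ℚ)) p).toTopRep)
      (P : (W'.baseChange (Place.Completion (Sum.inr ((primesEquiv (R := 𝓞 ℚ)).symm ⟨p, hp.out⟩) : Place ℚ))).toAffine.Point),
      ((tatePairingPoint W' (Place.Completion (Sum.inr ((primesEquiv (R := 𝓞 ℚ)).symm ⟨p, hp.out⟩) : Place ℚ)) p e hμ hadd₁ hadd₂ hgal hcompat (oneCocycleClass _ η₀) P : ℤ_[p]) : ℚ_[p]) =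
      Algebra.trace ℚ_[p] (Place.Completion (Sum.inr ((primesEquiv (R := 𝓞 ℚ)).symm ⟨p, hp.out⟩) : Place ℚ))
      (c * expStarCoord W' (valuation_place_lt_one p ((primesEquiv (R := 𝓞 ℚ)).symm ⟨p, hp.out⟩)) d₀ η₀ *
      padicLogPointFiniteExt wv (W'.baseChange (Place.Completion (Sum.inr ((primesEquiv (R := 𝓞 ℚ)).symm ⟨p, hp.out⟩) : Place ℚ))) p P)) ∧
      (∀ (ηT : contOneCocycles ((restrictedTateRep W' (Place.Completion (Sum.inr ((primesEquiv (R := 𝓞 ℚ)).symm ⟨p, hp.out⟩) : Place ℚ)) p).restrict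
      (absGaloisRestrict (Place.Completion (Sum.inr ((primesEquiv (R := 𝓞 ℚ)).symm ⟨p, hp.out⟩) : Place ℚ)) (w.1.adicCompletion (CyclotomicField m ℚ)))).toTopRep)
      (P : (W'.baseChange (w.1.adicCompletion (CyclotomicField m ℚ))).toAffine.Point),
      ((tatePairingPointTower W' (Place.Completion (Sum.inr ((primesEquiv (R := 𝓞 ℚ)).symm ⟨p, hp.out⟩) : Place ℚ)) e hμ hadd₁ hadd₂ hgal hcompat (oneCocycleClass _ ηT) P : ℤ_[p]) : ℚ_[p]) =
      Algebra.trace ℚ_[p] (w.1.adicCompletion (CyclotomicField m ℚ))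
      (algebraMap (Place.Completion (Sum.inr ((primesEquiv (R := 𝓞 ℚ)).symm ⟨p, hp.out⟩) : Place ℚ)) (w.1.adicCompletion (CyclotomicField m ℚ)) c * expStarCoordTower W' (F₀ := (Place.Completion (Sum.inr ((primesEquiv (R := 𝓞 ℚ)).symm ⟨p, hp.out⟩) : Place ℚ))) hL d ηT *
      padicLogPointFiniteExt ν (W'.baseChange (w.1.adicCompletion (CyclotomicField m ℚ))) p P)) := by
  intro W' _ _ p hp hp57 hadd hirr hIstar h4 hsel m _ hm w hw _ _ _ hL wv _ _ ν _ _ e hμ hadd₁ hadd₂ hgal hnondeg hcompat d₀ d hcli₀ hde₀ hcli hde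
    hcomp
  have hp5 : 5 ≤ p := by rcases hp57 with rfl | rfl <;> norm_num
  have hgen : natGenerator (placeOf p) = p := congrArg Subtype.val ((primesEquiv (R := ℤ)).apply_symm_apply ⟨p, hp.out⟩)
  obtain ⟨-, hvΔ⟩ := padicValRat_j_nonneg_and_mem_of_starred W' p hp5 hadd (fun n => hIstar (placeOf p) n hgen) h4
  -- the cell's ramification index `e` (Tate's table: ord_p Δ_min ∈ {8, 9, 10}; the selector forces `(5; III*)` / excludes `(7; III*)`)
  obtain ⟨e', he', htab⟩ : ∃ e' : ℕ, 0 < e' ∧ (p = 5 ∧ padicValInt p W'.minimalDiscriminantInt = 9 ∧ e' = 4 ∨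
      p = 7 ∧ padicValInt p W'.minimalDiscriminantInt = 8 ∧ e' = 3 ∨ p = 7 ∧ padicValInt p W'.minimalDiscriminantInt = 10 ∧ e' = 6) := by
    rcases hp57 with rfl | rfl
    · exact ⟨4, by norm_num, Or.inl ⟨rfl, hsel.1 rfl, rfl⟩⟩
    · have h9 : padicValInt 7 W'.minimalDiscriminantInt ≠ 9 := fun h => by have := hsel.2 h; norm_num at this
      rcases hvΔ with h8 | h9' | h10
      · exact ⟨3, by norm_num, Or.inr (Or.inl ⟨rfl, h8, rfl⟩)⟩
      · exact absurd h9' h9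
      · exact ⟨6, by norm_num, Or.inr (Or.inr ⟨rfl, h10, rfl⟩)⟩
  -- K-DATA: `K = ℚ(ζ_m, p^{1/e})`, a place `w′ ∣ w`, the packet keys of `K_{w′}`, the compatible norm valuation
  obtain ⟨K, _, _, _, _, α, hα, hpl⟩ := StarredOptimalManinUnitFiveSevenRecTowerKData.exists_numberField_over_cyclotomic_pow_eq_prime m he' p
  obtain ⟨w', hw'⟩ := hpl w.1 hw
  haveI : CharZero (w'.1.adicCompletion K) := LocalField.charZero_adicCompletion w'.1
  have hp' : valuation (w'.1.adicCompletion K) ((p : ℕ) : w'.1.adicCompletion K) < 1 := LocalField.valuation_adicCompletion_natCast_lt_one w'.1 p hw'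
  haveI : Fact (¬ IsUnit ((p : ℕ) : integerC (w'.1.adicCompletion K))) := ⟨not_isUnit_natCast_integerC hp'⟩
  haveI : IsAdicComplete (Ideal.span {((p : ℕ) : integerC (w'.1.adicCompletion K))}) (integerC (w'.1.adicCompletion K)) :=
    isAdicComplete_integerC_natCast hp'
  haveI := compatible_normValuation_adicCompletion (K := K) w'.1
  haveI : (W'.baseChange (w'.1.adicCompletion K)).IsIntegral (NormedField.valuation : Valuation (w'.1.adicCompletion K) ℝ≥0).integer :=
    KPort.Kw.isIntegral_baseChange_of_isGloballyMinimal _ W'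
  letI := LocalField.adicCompletionPadicAlgebra w.1 p hw
  letI : Algebra (Place.Completion (K := ℚ) (Sum.inr ((primesEquiv (R := 𝓞 ℚ)).symm ⟨p, hp.out⟩))) (w.1.adicCompletion (CyclotomicField m ℚ)) :=
    inferInstanceAs (Algebra (((primesEquiv (R := 𝓞 ℚ)).symm ⟨p, hp.out⟩).adicCompletion ℚ) (w.1.adicCompletion (CyclotomicField m ℚ)))
  letI := LocalField.adicCompletionPadicAlgebra w'.1 p hw'
  -- the Prop-1.2.3 binders of the direct representation over `K_{w′}`: de Rham ascent `ℚ_v → L_w → K_{w′}` + Kato II Prop. 1.2.3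
  have hcont : Continuous (algebraMap (Place.Completion (Sum.inr ((primesEquiv (R := 𝓞 ℚ)).symm ⟨p, hp.out⟩) : Place ℚ)) (w.1.adicCompletion (CyclotomicField m ℚ))) := w.adicCompletionSemialgHom_continuous ℚ (CyclotomicField m ℚ)
  haveI : Module.Finite ℚ_[p] (W'.rationalTateModule p) := module_finite_rationalTateModule_holds W' p
  have hDRK : GaloisRep.IsDeRham (bdRPeriodRingData (F := w'.1.adicCompletion K) (p := p) hp')
      (restrictedRationalTateRep W' (w'.1.adicCompletion K) p) :=
    isDeRham_restrictedRationalTateRep_of_tower W' (w'.adicCompletionSemialgHom_continuous (CyclotomicField m ℚ) K) hL hp'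
      (isDeRham_restrictedRationalTateRep_of_tower W' hcont (valuation_place_lt_one p ((primesEquiv (R := 𝓞 ℚ)).symm ⟨p, hp.out⟩)) hL
        (isDeRham_place_of_starredCell W' p hp57 hadd hirr hIstar h4))
  obtain ⟨hinjK, hdeK⟩ := cupLogInjective_and_hasDualExp_of_isDeRham_holds hp' (restrictedRationalTateRep W' (w'.1.adicCompletion K) p) hDRK
  exact recTowerAt_cyclotomic_cells_of_formula_over_completion W' p hp57 hadd hirr hIstar h4 m w hw hL wv ν w' hw' hp'
    (NormedField.valuation : Valuation (w'.1.adicCompletion K) ℝ≥0) e hμ hadd₁ hadd₂ hgal hcompat hnondeg hcli hde d₀ d hcomp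
    (hloc W' p hp57 hadd hirr hIstar h4 hsel α e' htab hα w'.1 hw' hp' NormedField.valuation e hμ hadd₁ hadd₂ hgal hnondeg hcompat hinjK hdeK)

end Summit.BirchSwinnertonDyer.BirchSwinnertonDyer.Theorems.StarredOptimalManinUnitFiveSevenRecTowerCellsOfLocalFormula

end
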